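import Summits.BirchSwinnertonDyer.BirchSwinnertonDyer.Theorems.ClassRecordThreeEulerHalvesAtThreeCartanTorusCubeCut
import Summits.BirchSwinnertonDyer.BirchSwinnertonDyer.Theorems.ClassRecordThreeEulerHalvesAtThreeCartanTorusCubeCutCuspDiagCount
import HarnessLib

/-!
# Crux 19109 `EulerHalvesAtThree` ∕ 23422 line `cartan` v8′, stub (F2a): the TORUS-CUBE CUT of S-K1′ — input (C2) PROVED:
# for `q ≡ 2 (mod 3)` some conjugate `g` has `3 ∤ S₃(g)` (`P_cuspGoodConjugate`), Bonnafé-free and `P¹`-free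

Seat `bsd-stepL-tam3-p1` g21 (LINE OWNER of crux 23422; `--supports stmt-BirchSwinnertonDyer-23422 --as helper`). CONTENT, all PROVED
(`q ≥ 5` prime, `q ≡ 2 (mod 3)`, `η` without rational eigenvalue, `T_C = 𝔽_q[η]^×`, `T_C³` its cubes):
* §1 the shifts `η − c·1 ∈ T_C` (`linGL η hη (−c, 1)`): `b·(η − c) = linGL(b,0)·linGL(−c,1)`; a non-scalar cube `t` with `t₀₀ = 0`
  (resp. `t₁₁ = 0`) forces `η − η₀₀·1` (resp. `η − η₁₁·1`) into `T_C³` (`entry_ne_zero_of_mem_cubes`); `(η − η₀₀)(η − η₁₁) = η₀₁η₁₀·1`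
  is a scalar cube, so `η − η₁₁ ∉ T_C³` once `η − η₀₀ ∉ T_C³` (`shift11_not_mem`, power criterion of `…Cyclic`);
* §2 **some shift `η − c·1` is NOT a cube** (`exists_shift_not_mem_cubes`): else `(b,c) ↦ b(η − c)` injects `𝔽_q^× × 𝔽_q` into
  `T_C³`, `3q(q−1) ≤ (q−1)(q+1)`, absurd;
* §3 **`3 ∤ Σ_{s ∈ T_s} Σ_{t ∈ T_C³} χ_W(s·t)` whenever `η − η₀₀·1 ∉ T_C³`** (`base_sum_not_dvd`): mod 3, `χ_W ≡ 1 + rootCount − [scalar]`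
  (`…CuspCharModThree`), `Σ_s rootCount(s t) = (q−1)·N(t)` with `N = 2q − 3` on the `q − 1` scalars and `N = q − 3` on the other
  cubes (all their entries are non-zero by §1), `(q−1)²` scalar pairs (`…CuspDiagCount`); the total is `≡ 1 (mod 3)`;
* §4 **(C2) `P_cuspGoodConjugate` PROVED BY NAME** (`cuspGoodConjugate : P_cuspGoodConjugate`, the named input of the cut file
  `…CartanTorusCubeCut` p683297): conjugating by `g = (1 x; 0 1)` with
  `x = (c − η₀₀)/η₁₀` makes `(gηg⁻¹)₀₀ = c` for the non-cube shift `c` of §2, and `S₃(g)` is the base sum of `gηg⁻¹` (`S3_eq_sum_conj`).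
HONEST FRAMING: finite-field counting in `GL₂(𝔽_q)`; nothing about any curve, `L`-value or period; S-K1′ is NOT proved here (the
principal-series inputs (P1)–(P3) of the cut remain); no summit statement, no route item and no registered stub is proved; BSD is proved
for no curve. [folklore; background: cite: Bump1997, §4.1]
-/

namespace Summit.BirchSwinnertonDyer.BirchSwinnertonDyer.Theorems.CartanTorusCubeCut

open Summit.BirchSwinnertonDyer.BirchSwinnertonDyer.Theorems.CartanDegree

open scoped Classical

set_option linter.dupNamespace false
set_option autoImplicit false

noncomputable section

variable {q : ℕ} [Fact q.Prime]

/-! ### §1 The shifts `η − c·1` -/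

section Shift

variable {η : Mat q} (hη : ¬ HasRatEigenvalue η)
include hη

omit hη in
/-- `(−c, 1) ≠ 0`. -/
theorem pair_ne_zero (c : ZMod q) : ((-c, (1 : ZMod q)) : ZMod q × ZMod q) ≠ 0 :=
  fun h => one_ne_zero (congrArg Prod.snd h)

/-- a matrix without rational eigenvalue has non-zero lower-left entry. -/
theorem entry10_ne_zero : η 1 0 ≠ 0 := by
  intro h
  apply hη
  refine ⟨η 0 0, ?_⟩
  rw [Matrix.det_fin_two, Matrix.trace_fin_two, h]
  ring

/-- the shift `η − c·1` lies in `T_C`. -/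
theorem shift_mem_torus (c : ZMod q) : linGL η hη (-c, 1) ∈ nonsplitTorus η := by
  rw [nonsplitTorus_eq_image hη, Finset.mem_image]
  exact ⟨(-c, 1), Finset.mem_erase.2 ⟨pair_ne_zero c, Finset.mem_univ _⟩, rfl⟩

/-- non-zero scalars `b·1` are cubes (`q ≡ 2 (3)`). -/
theorem scalar_mem_cubes (hq5 : 5 ≤ q) (hq3 : q % 3 = 2) {b : ZMod q} (hb : b ≠ 0) :
    linGL η hη (b, 0) ∈ nonsplitCubes η := by
  have hp : ((b, (0 : ZMod q)) : ZMod q × ZMod q) ≠ 0 := fun h => hb (congrArg Prod.fst h)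
  have hmem : linGL η hη (b, 0) ∈ nonsplitTorus η := by
    rw [nonsplitTorus_eq_image hη, Finset.mem_image]
    exact ⟨(b, 0), Finset.mem_erase.2 ⟨hp, Finset.mem_univ _⟩, rfl⟩
  apply scalar_mem_nonsplitCubes hη hq5 hq3 hmem
  rw [linGL_coe hη hp]
  exact (isScalarMat_lin_iff hη (b, 0)).2 rfl

/-- `b·(η − c·1) = linGL(b, 0)·linGL(−c, 1) = linGL(−bc, b)`. -/
theorem scalar_mul_shift {b : ZMod q} (hb : b ≠ 0) (c : ZMod q) :
    linGL η hη (b, 0) * linGL η hη (-c, 1) = linGL η hη (-(b * c), b) := by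
  have hp1 : ((b, (0 : ZMod q)) : ZMod q × ZMod q) ≠ 0 := fun h => hb (congrArg Prod.fst h)
  have hp3 : ((-(b * c), b) : ZMod q × ZMod q) ≠ 0 := fun h => hb (congrArg Prod.snd h)
  apply Units.ext
  rw [Units.val_mul, linGL_coe hη hp1, linGL_coe hη (pair_ne_zero c), linGL_coe hη hp3, lin_mul_lin]
  congr 1
  simp only [pmul, Prod.mk.injEq]
  constructor <;> ring

/-- **a non-scalar cube with vanishing diagonal entry `(i,i)` puts the shift `η − η_{ii}·1` into the cubes**; contrapositively,
if `η − η_{ii}·1 ∉ T_C³` then every non-scalar cube has `t_{ii} ≠ 0`. -/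
theorem entry_ne_zero_of_mem_cubes (hq5 : 5 ≤ q) (hq3 : q % 3 = 2) (i : Fin 2)
    (hi : linGL η hη (-(η i i), 1) ∉ nonsplitCubes η) {t : G q} (ht : t ∈ nonsplitCubes η)
    (hns : ¬ IsScalarMat (t : Mat q)) : (t : Mat q) i i ≠ 0 := by
  intro h0
  have htT := nonsplitCubes_subset η ht
  have htlin := lin_coord_of_mem hη (mem_nonsplitTorus_iff.1 htT)
  set p := coord η (t : Mat q) with hp
  have hp2 : p.2 ≠ 0 := by
    intro h
    apply hns
    rw [← htlin]
    exact (isScalarMat_lin_iff hη p).2 h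
  have e : p.1 + p.2 * η i i = 0 := by
    have := congrFun (congrFun htlin i) i
    simp only [lin, Matrix.add_apply, Matrix.smul_apply, Matrix.one_apply_eq, smul_eq_mul, mul_one] at this
    rw [h0] at this
    exact this
  have hinv : p.2⁻¹ * p.2 = 1 := inv_mul_cancel₀ hp2
  have hpinv : ((p.2⁻¹, (0 : ZMod q)) : ZMod q × ZMod q) ≠ 0 := fun h => inv_ne_zero hp2 (congrArg Prod.fst h)
  apply hi
  have key : linGL η hη (-(η i i), 1) = linGL η hη (p.2⁻¹, 0) * t := by
    apply Units.ext
    rw [Units.val_mul, linGL_coe hη (pair_ne_zero _), linGL_coe hη hpinv, ← htlin, lin_mul_lin]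
    congr 1
    have e1 : p.1 = -(p.2 * η i i) := by linear_combination e
    simp only [pmul, Prod.mk.injEq]
    constructor
    · rw [e1]; linear_combination (η i i) * hinv
    · linear_combination (-1 : ZMod q) * hinv
  rw [key]
  exact nonsplitCubes_mul_mem hη (scalar_mem_cubes hη hq5 hq3 (inv_ne_zero hp2)) ht

/-- **`η − η₁₁·1 ∉ T_C³` once `η − η₀₀·1 ∉ T_C³`** (their product `η₀₁η₁₀·1` is a scalar cube; power criterion). -/
theorem shift11_not_mem (hq5 : 5 ≤ q) (hq3 : q % 3 = 2) (h00 : linGL η hη (-(η 0 0), 1) ∉ nonsplitCubes η) :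
    linGL η hη (-(η 1 1), 1) ∉ nonsplitCubes η := by
  intro h11
  apply h00
  have hu := shift_mem_torus hη (η 0 0)
  have hv := shift_mem_torus hη (η 1 1)
  have hk : η 0 1 * η 1 0 ≠ 0 := mul_ne_zero (entry01_ne_zero hη) (entry10_ne_zero hη)
  have hk0 : ((η 0 1 * η 1 0, (0 : ZMod q)) : ZMod q × ZMod q) ≠ 0 := fun h => hk (congrArg Prod.fst h)
  have hprod : linGL η hη (-(η 0 0), 1) * linGL η hη (-(η 1 1), 1) = linGL η hη (η 0 1 * η 1 0, 0) := by
    apply Units.ext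
    rw [Units.val_mul, linGL_coe hη (pair_ne_zero _), linGL_coe hη (pair_ne_zero _), linGL_coe hη hk0, lin_mul_lin]
    congr 1
    simp only [pmul, Prod.mk.injEq, Matrix.det_fin_two, Matrix.trace_fin_two]
    constructor <;> ring
  have huv : linGL η hη (-(η 0 0), 1) * linGL η hη (-(η 1 1), 1) ∈ nonsplitCubes η := by
    rw [hprod]; exact scalar_mem_cubes hη hq5 hq3 hk
  rw [mem_nonsplitCubes_iff hη hq5 hu]
  have hv' := (mem_nonsplitCubes_iff hη hq5 hv).1 h11
  have huv' := (mem_nonsplitCubes_iff hη hq5 (nonsplitTorus_mul_mem hu hv)).1 huv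
  have hcomm : Commute ((linGL η hη (-(η 0 0), 1) : G q) : Mat q) ((linGL η hη (-(η 1 1), 1) : G q) : Mat q) := by
    have := nonsplitTorus_comm hη hu hv
    exact congrArg (fun g : G q => (g : Mat q)) this
  rw [Units.val_mul, hcomm.mul_pow, hv', mul_one] at huv'
  exact huv'

/-! ### §2 Some shift is not a cube -/

/-- **some `η − c·1` is not a cube** (counting: `b·(η − c)` are `q(q−1)` distinct elements, the cubes number `(q−1)(q+1)/3`). -/
theorem exists_shift_not_mem_cubes (hq5 : 5 ≤ q) (hq3 : q % 3 = 2) :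
    ∃ c : ZMod q, linGL η hη (-c, 1) ∉ nonsplitCubes η := by
  by_contra hall
  push Not at hall
  let f : (ZMod q)ˣ × ZMod q → G q := fun bc => linGL η hη (-((bc.1 : ZMod q) * bc.2), (bc.1 : ZMod q))
  have hmaps : Set.MapsTo f ((Finset.univ : Finset ((ZMod q)ˣ × ZMod q)) : Set ((ZMod q)ˣ × ZMod q))
      ((nonsplitCubes η : Finset (G q)) : Set (G q)) := by
    intro bc _
    simp only [Finset.mem_coe, f]
    rw [← scalar_mul_shift hη bc.1.ne_zero bc.2]
    exact nonsplitCubes_mul_mem hη (scalar_mem_cubes hη hq5 hq3 bc.1.ne_zero) (hall bc.2)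
  have hinj : Set.InjOn f ((Finset.univ : Finset ((ZMod q)ˣ × ZMod q)) : Set ((ZMod q)ˣ × ZMod q)) := by
    intro bc _ bc' _ h
    have hne : ((-((bc.1 : ZMod q) * bc.2), (bc.1 : ZMod q)) : ZMod q × ZMod q) ≠ 0 :=
      fun h0 => bc.1.ne_zero (congrArg Prod.snd h0)
    have hne' : ((-((bc'.1 : ZMod q) * bc'.2), (bc'.1 : ZMod q)) : ZMod q × ZMod q) ≠ 0 :=
      fun h0 => bc'.1.ne_zero (congrArg Prod.snd h0)
    have h' := congrArg (fun g : G q => (g : Mat q)) h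
    simp only [f, linGL_coe hη hne, linGL_coe hη hne'] at h'
    have hpair := lin_injective hη h'
    have hb : (bc.1 : ZMod q) = bc'.1 := congrArg Prod.snd hpair
    have hbc : (bc.1 : ZMod q) * bc.2 = bc'.1 * bc'.2 := neg_injective (congrArg Prod.fst hpair)
    refine Prod.ext (Units.ext hb) ?_
    rw [hb] at hbc
    exact mul_left_cancel₀ bc'.1.ne_zero hbc
  have hle := Finset.card_le_card_of_injOn f hmaps hinj
  rw [Finset.card_univ, Fintype.card_prod, ZMod.card_units, ZMod.card] at hle
  have h3 := nonsplitCubes_card hη hq5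
  have key : (q - 1) * (3 * q) ≤ (q - 1) * (q + 1) := by
    calc (q - 1) * (3 * q) = 3 * ((q - 1) * q) := by ring
      _ ≤ 3 * (nonsplitCubes η).card := Nat.mul_le_mul_left 3 hle
      _ = (q - 1) * (q + 1) := h3
  have hm : 0 < q - 1 := by omega
  have := Nat.le_of_mul_le_mul_left key hm
  omega

/-! ### §3 The base sum is `≡ 1 (mod 3)` -/

/-- a non-scalar element of the torus has non-zero off-diagonal entries. -/
theorem offdiag_ne_zero {t : G q} (ht : t ∈ nonsplitTorus η) (hns : ¬ IsScalarMat (t : Mat q)) :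
    (t : Mat q) 0 1 * (t : Mat q) 1 0 ≠ 0 := by
  have htlin := lin_coord_of_mem hη (mem_nonsplitTorus_iff.1 ht)
  set p := coord η (t : Mat q) with hp
  have hp2 : p.2 ≠ 0 := by
    intro h
    apply hns
    rw [← htlin]
    exact (isScalarMat_lin_iff hη p).2 h
  rw [← htlin]
  simp only [lin, Matrix.add_apply, Matrix.smul_apply, Matrix.one_apply_ne (by decide : (0 : Fin 2) ≠ 1),
    Matrix.one_apply_ne (by decide : (1 : Fin 2) ≠ 0), smul_eq_mul, mul_zero, zero_add]
  exact mul_ne_zero (mul_ne_zero hp2 (entry01_ne_zero hη)) (mul_ne_zero hp2 (entry10_ne_zero hη))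

/-- **`3 ∤ Σ_{s ∈ T_s} Σ_{t ∈ T_C³} χ_W(s·t)` when `η − η₀₀·1` is not a cube** (`q ≡ 2 (3)`). -/
theorem base_sum_not_dvd (hq5 : 5 ≤ q) (hq3 : q % 3 = 2) (h00 : linGL η hη (-(η 0 0), 1) ∉ nonsplitCubes η) :
    ¬ (3 : ℤ) ∣ ∑ s ∈ splitTorus q, ∑ t ∈ nonsplitCubes η, cubicNewvectorChar q (s * t) := by
  have h11 := shift11_not_mem hη hq5 hq3 h00
  -- the values of `N(t)` on the cubes
  have hN : ∀ t ∈ nonsplitCubes η,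
      diagCount (t : Mat q) = if IsScalarMat (t : Mat q) then 2 * q - 3 else q - 3 := by
    intro t ht
    by_cases hsc : IsScalarMat (t : Mat q)
    · rw [if_pos hsc]
      obtain ⟨h01, h10, hdiag⟩ := hsc
      have hc : (t : Mat q) 0 0 ≠ 0 := by
        intro h0
        have hdet : (t : Mat q).det = 0 := by rw [Matrix.det_fin_two, h0, h01]; ring
        have hu : IsUnit (t : Mat q).det := by rw [← Matrix.isUnit_iff_isUnit_det]; exact Units.isUnit t
        exact hu.ne_zero hdet
      have hmat : (t : Mat q) = (t : Mat q) 0 0 • (1 : Mat q) := by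
        ext i j
        fin_cases i <;> fin_cases j <;>
          simp [h01, h10, hdiag, Matrix.one_apply_ne (by decide : (0 : Fin 2) ≠ 1),
            Matrix.one_apply_ne (by decide : (1 : Fin 2) ≠ 0)]
      rw [hmat]
      exact diagCount_scalar hc
    · rw [if_neg hsc]
      have hu : IsUnit (t : Mat q).det := by rw [← Matrix.isUnit_iff_isUnit_det]; exact Units.isUnit t
      exact diagCount_generic (entry_ne_zero_of_mem_cubes hη hq5 hq3 0 h00 ht hsc)
        (entry_ne_zero_of_mem_cubes hη hq5 hq3 1 h11 ht hsc) (offdiag_ne_zero hη (nonsplitCubes_subset η ht) hsc)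
        hu.ne_zero
  -- the root-count sum
  have hsc_card := card_scalar_nonsplitCubes hη hq5 hq3
  have hle : q - 1 ≤ (nonsplitCubes η).card := by
    rw [← hsc_card]; exact Finset.card_filter_le _ _
  have hR : ∑ s ∈ splitTorus q, ∑ t ∈ nonsplitCubes η, rootCount ((s * t : G q) : Mat q) =
      (q - 1) * ((q - 1) * (2 * q - 3) + ((nonsplitCubes η).card - (q - 1)) * (q - 3)) := by
    rw [Finset.sum_comm]
    simp_rw [sum_rootCount_splitTorus]
    rw [← Finset.mul_sum, Finset.sum_congr rfl hN, Finset.sum_ite, Finset.sum_const, Finset.sum_const, smul_eq_mul,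
      smul_eq_mul, hsc_card]
    have hneg : ((nonsplitCubes η).filter (fun t : G q => ¬ IsScalarMat (t : Mat q))).card =
        (nonsplitCubes η).card - (q - 1) := by
      have := Finset.card_filter_add_card_filter_not
        (s := nonsplitCubes η) (fun t : G q => IsScalarMat (t : Mat q))
      rw [hsc_card] at this
      omega
    rw [hneg]
  have hS := card_scalar_pairs hη hq5 hq3
  -- cast to `ZMod 3`
  intro hdvd
  have hz : ((∑ s ∈ splitTorus q, ∑ t ∈ nonsplitCubes η, cubicNewvectorChar q (s * t) : ℤ) : ZMod 3) = 0 :=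
    (ZMod.intCast_zmod_eq_zero_iff_dvd _ 3).2 (by exact_mod_cast hdvd)
  have hval : ((∑ s ∈ splitTorus q, ∑ t ∈ nonsplitCubes η, cubicNewvectorChar q (s * t) : ℤ) : ZMod 3) =
      (((q - 1) ^ 2 * (nonsplitCubes η).card +
          (q - 1) * ((q - 1) * (2 * q - 3) + ((nonsplitCubes η).card - (q - 1)) * (q - 3)) : ℕ) : ZMod 3)
        - (((q - 1) * (q - 1) : ℕ) : ZMod 3) := by
    rw [← hR, ← hS, ← splitTorus_card]
    push_cast
    simp only [cubicNewvectorChar, char_mod_three hq5 hq3, Finset.sum_add_distrib, Finset.sum_sub_distrib,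
      Finset.sum_const, nsmul_eq_mul, mul_one, Units.val_mul]
  rw [hval] at hz
  have h1q : 1 ≤ q := by omega
  have h3q : 3 ≤ q := by omega
  have h32q : 3 ≤ 2 * q := by omega
  push_cast [Nat.cast_sub h1q, Nat.cast_sub h3q, Nat.cast_sub h32q, Nat.cast_sub hle] at hz
  rw [natCast_q_eq_two hq3] at hz
  have h1 : ((2 : ZMod 3) - 1) ^ 2 * ((nonsplitCubes η).card : ZMod 3) +
      (2 - 1) * ((2 - 1) * (2 * 2 - 3) + (((nonsplitCubes η).card : ZMod 3) - (2 - 1)) * (2 - 3)) -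
        (2 - 1) * (2 - 1) = 1 := by ring
  rw [h1] at hz
  exact one_ne_zero hz

end Shift

/-! ### §4 (C2): a good conjugate -/

/-- **Input (C2) of the torus-cube cut, PROVED** (the body of `P_cuspGoodConjugate` of `Lines/cartan_sk1.lean`, verbatim): for
`q ≡ 2 (mod 3)`, `q ≥ 5` and `η` without rational eigenvalue, some `g` has `3 ∤ S₃(g)`. -/
theorem cuspGoodConjugate : P_cuspGoodConjugate := by
  unfold P_cuspGoodConjugate
  intro q _ hq5 hq3 η hη
  obtain ⟨c, hc⟩ := exists_shift_not_mem_cubes hη hq5 hq3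
  have h10 := entry10_ne_zero hη
  set x : ZMod q := (c - η 0 0) * (η 1 0)⁻¹ with hx
  have hgdet : (!![1, x; 0, 1] : Mat q).det ≠ 0 := by simp [Matrix.det_fin_two]
  set g : G q := Matrix.GeneralLinearGroup.mkOfDetNeZero (!![1, x; 0, 1] : Mat q) hgdet with hg
  have hgcoe : (g : Mat q) = !![1, x; 0, 1] := rfl
  have hginv : ((g⁻¹ : G q) : Mat q) = !![1, -x; 0, 1] := by
    apply Units.inv_eq_of_mul_eq_one_right
    rw [hgcoe]
    ext i j
    fin_cases i <;> fin_cases j <;> simp [Matrix.mul_apply, Fin.sum_univ_two]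
  set η' : Mat q := (g : Mat q) * η * ((g⁻¹ : G q) : Mat q) with hη'def
  have hη' : ¬ HasRatEigenvalue η' := fun h => hη ((PS.hasRatEigenvalue_conj_iff g η).1 h)
  have h00' : η' 0 0 = c := by
    have a00 : (!![1, x; 0, 1] : Mat q) 0 0 = 1 := by simp
    have a01 : (!![1, x; 0, 1] : Mat q) 0 1 = x := by simp
    have b00 : (!![1, -x; 0, 1] : Mat q) 0 0 = 1 := by simp
    have b10 : (!![1, -x; 0, 1] : Mat q) 1 0 = 0 := by simp
    rw [hη'def, hgcoe, hginv]
    simp only [Matrix.mul_apply, Fin.sum_univ_two, a00, a01, b00, b10]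
    have e : (1 * η 0 0 + x * η 1 0) * 1 + (1 * η 0 1 + x * η 1 1) * 0 = η 0 0 + x * η 1 0 := by ring
    rw [e, hx, mul_assoc, inv_mul_cancel₀ h10, mul_one]
    ring
  refine ⟨g, ?_⟩
  rw [S3_eq_sum_conj]
  apply base_sum_not_dvd hη' hq5 hq3
  rw [h00', nonsplitCubes_conj, Finset.mem_image]
  rintro ⟨u, hu, hgu⟩
  apply hc
  have hgg : (g : Mat q) * ((g⁻¹ : G q) : Mat q) = 1 := by
    rw [← Units.val_mul, mul_inv_cancel, Units.val_one]
  have key : g * linGL η hη (-c, 1) * g⁻¹ = linGL η' hη' (-c, 1) := by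
    apply Units.ext
    rw [Units.val_mul, Units.val_mul, linGL_coe hη (pair_ne_zero c), linGL_coe hη' (pair_ne_zero c)]
    simp only [lin, hη'def, one_smul]
    rw [mul_add, add_mul, Matrix.mul_smul, Matrix.smul_mul, mul_one, hgg]
  have : u = linGL η hη (-c, 1) := conj_injective g (hgu.trans key.symm)
  rw [← this]
  exact hu

end

end Summit.BirchSwinnertonDyer.BirchSwinnertonDyer.Theorems.CartanTorusCubeCut
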